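import Literature.NumberTheory.Automorphic.UnitaryGroupRankOneBigCell
import HarnessLib

/-!
# The quasi-split `U(3)` over a valued field with ANY isometric involution — II: the IWASAWA decomposition `U = K₀·B` and
# `N·T ⊂ K₀·T·K₀` (the big cell absorbs the non-integral unipotents)

Topic `NumberTheory/Automorphic`; namespace `Literature.NumberTheory.Automorphic.UnitaryGroup`.  THEOREMS ONLY (no `def`, no `instance`,
no notation, no named fact, no `sorry`; axioms ⊆ {propext, Classical.choice, Quot.sound}).  File 2 of 3 of road (δ) «ELEMENTARY CARTAN for
ANY quadratic `σ`» (cell `pub/hodgecm-mathlib`, crux `H413` = `stmt-HodgeConjecture-24833`, desk F0P2-plan (g8)); continues ★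
`UnitaryGroupRankOneBigCell`.  HONEST LABEL: HC_CM is proved only modulo the printed citations until rung 0 closes; this file discharges
nothing by itself.

SETTING as in file I: `K` with `Valued K ℤᵐ⁰`, `σ` an involution (`hσσ`) with `|σx| = |x|` (`hσv`), `U = U(σ, Φ₃)(K)`, `K₀ = U ∩ GL₃(𝒪)`,
`B = T N`, `w₀`.  Ramified `K/K^σ` and residue characteristic `2` are allowed throughout.

* §1 **IWASAWA** `exists_glInt_mul_borel : ∀ g ∈ U, ∃ k ∈ K₀, ∃ b ∈ B, g = k b` — `K₀` is TRANSITIVE on isotropic lines: the first column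
  `c` of `g` is isotropic (`col_zero_isotropic`: `σc₀c₂ + σc₁c₁ + σc₂c₀ = 0`), so its maximal valuation sits at `c₀` or `c₂`
  (`not_v_lt_and_v_lt`: `|c₁|² = |σc₀c₂ + σc₂c₀| ≤ |c₀||c₂|` forbids a strict maximum at `c₁` — this is where «a primitive isotropic vector
  has a unit end-coordinate» replaces the trace-surjectivity used for unramified hermitian lattices); then the INTEGRAL lower unitriangular
  `ū(-σ(c₁/c₀), c₂/c₀)` (case `|c₀|` max, `exists_glInt_mul_borel_of_v_le`) or its `w₀`-flip moves `g e₀` to `K e₀`, and the stabiliser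
  of the isotropic line `K e₀` in `U` is `B`.
* §2 **`N·T ⊂ K₀·T·K₀`** (`exists_unipotent_mul_torus_eq`): CORE `exists_torus_mul_unipotent_eq` — for `t = diag(d) ∈ T` with `|d₀| ≥ 1` and
  `n = u(x,z)`: if `|z| ≤ 1` then `n ∈ K₀` (`|x|² ≤ |z|`); else the big cell `n = k₁ D w₀ k₂` of file I has `k₁, k₂ ∈ N̄ ∩ K₀`
  (`|x/z| ≤ |z|^{-1/2}`), and `t n = (t k₁ t⁻¹)(t D)(w₀ k₂)` with `t k₁ t⁻¹` STILL integral (conjugation divides the lower entries by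
  `d₀/d₁, d₀/d₂, d₁/d₂`, all of valuation `≥ 1`); the cases `|d₀| < 1` and `n` on the left follow by `t⁻¹ n t ∈ N` and `(nt)⁻¹ = t⁻¹n⁻¹`.

## References
* [Rogawski1990] J. D. Rogawski, *Automorphic Representations of Unitary Groups in Three Variables*, Ann. of Math. Stud. 123 (1990),
  §1.9 p. 8 (the form `Φ` and `U(Φ)`), §1.10 p. 9 (`B = MN`, `N = {u(x, z)}`, `M = {d(α, β, ᾱ⁻¹)}`, the Weyl element), §12.2 p. 173.
* [BruhatTits1972] F. Bruhat, J. Tits, *Groupes réductifs sur un corps local I*, Publ. Math. IHÉS 41 (1972), (4.4.3) (Iwasawa and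
  Cartan decompositions `G = K·B`, `G = K·A⁺·K` for a good maximal compact `K`).
* [Tits1979] J. Tits, *Reductive groups over local fields*, Proc. Sympos. Pure Math. 33.1 (1979), §3.3.2–§3.3.3.
* [Casselman1995] W. Casselman, *Introduction to the theory of admissible representations of `p`-adic reductive groups* (1995 notes),
  Prop. 1.3.1 (rank-one Bruhat cells), Thm. 5.3.1 (Harish-Chandra's criterion — the consumer).
* [PlatonovRapinchuk1994] V. Platonov, A. Rapinchuk, *Algebraic Groups and Number Theory* (1994), §3.3 (`GL_n(𝒪)` and its conjugates).
* [Serre1979] J.-P. Serre, *Local Fields*, GTM 67 (1979), Ch. I §1, Ch. II §1 (discrete valuations, uniformisers, the ultrametric inequality).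
-/

set_option autoImplicit false

open scoped MatrixGroups Pointwise Topology WithZero
open ValuativeRel Matrix

namespace Literature.NumberTheory.Automorphic

namespace UnitaryGroup

/-- `rev 0 = 2` in `Fin 3`. [folklore] -/
private theorem rev0' : Fin.rev (0 : Fin 3) = 2 := rfl

/-- `rev 1 = 1` in `Fin 3`. [folklore] -/
private theorem rev1' : Fin.rev (1 : Fin 3) = 1 := rfl

/-- `rev 2 = 0` in `Fin 3`. [folklore] -/
private theorem rev2' : Fin.rev (2 : Fin 3) = 0 := rfl

/-- A `3 × 3` diagonal matrix written out (private copy). [folklore] -/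
private theorem diagonal_three_eq' {K : Type*} [Field K] (p q r : K) : Matrix.diagonal ![p, q, r] = !![p, 0, 0; 0, q, 0; 0, 0, r] := by
  ext i j
  fin_cases i <;> fin_cases j <;> simp

/-! ## §1 The Iwasawa decomposition `U = K₀ · B` from the transitivity of `K₀` on isotropic lines -/

section Iwasawa

variable {K : Type*} [Field K] [Valued K ℤᵐ⁰] [ValuativeRel K] [(Valued.v : Valuation K ℤᵐ⁰).Compatible]
  (σ : K →+* K) {J : Matrix (Fin 3) (Fin 3) K} (hJ : J = (StdForm.antidiagonal 3).over K)

omit [Valued K ℤᵐ⁰] [ValuativeRel K] [(Valued.v : Valuation K ℤᵐ⁰).Compatible] in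
include hJ in
/-- The first column `c = g e₀` of `g ∈ U(σ, Φ₃)` is ISOTROPIC: `σc₀ c₂ + σc₁ c₁ + σc₂ c₀ = 0`. [cite: Rogawski1990, §1.9 p. 8] -/
theorem col_zero_isotropic (g : ↥(unitaryGroupOfForm σ J)) :
    σ (((g : GL (Fin 3) K) : Matrix (Fin 3) (Fin 3) K) 0 0) * ((g : GL (Fin 3) K) : Matrix (Fin 3) (Fin 3) K) 2 0 +
      σ (((g : GL (Fin 3) K) : Matrix (Fin 3) (Fin 3) K) 1 0) * ((g : GL (Fin 3) K) : Matrix (Fin 3) (Fin 3) K) 1 0 +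
      σ (((g : GL (Fin 3) K) : Matrix (Fin 3) (Fin 3) K) 2 0) * ((g : GL (Fin 3) K) : Matrix (Fin 3) (Fin 3) K) 0 0 = 0 := by
  have h := sum_rel_of_mem σ hJ g 0 0
  simp only [Fin.sum_univ_three, rev0', rev1', rev2'] at h
  simpa using h

omit [Valued K ℤᵐ⁰] [ValuativeRel K] [(Valued.v : Valuation K ℤᵐ⁰).Compatible] in
/-- The first column of an invertible matrix is non-zero. [folklore] -/
private theorem col_zero_ne_zero (g : ↥(unitaryGroupOfForm σ J))
    (h0 : ((g : GL (Fin 3) K) : Matrix (Fin 3) (Fin 3) K) 0 0 = 0) (h1 : ((g : GL (Fin 3) K) : Matrix (Fin 3) (Fin 3) K) 1 0 = 0)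
    (h2 : ((g : GL (Fin 3) K) : Matrix (Fin 3) (Fin 3) K) 2 0 = 0) : False := by
  have h := congr_fun (congr_fun (Units.inv_mul (g : GL (Fin 3) K)) 0) 0
  rw [Matrix.mul_apply, Fin.sum_univ_three, h0, h1, h2, Matrix.one_apply_eq] at h
  simp at h

include hJ in
/-- **Transitivity of `K₀` on isotropic lines — the case `|c₀| = max`.**  If the first column `c` of `g ∈ U` has `|c₁|, |c₂| ≤ |c₀|`,
then `k := ū(-σ(c₁/c₀), c₂/c₀) ∈ K₀` (integral, unitary by isotropy of `c`) has `k e₀ ∝ c`, so `k⁻¹ g` fixes the line `K e₀`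
and is upper triangular: `g ∈ K₀ · B`. [cite: BruhatTits1972, (4.4.3)] [cite: Rogawski1990, §1.10 p. 9] -/
theorem exists_glInt_mul_borel_of_v_le (hσσ : ∀ x, σ (σ x) = x) (hσv : ∀ x, Valued.v (σ x) = Valued.v x)
    (g : ↥(unitaryGroupOfForm σ J))
    (h1 : Valued.v (((g : GL (Fin 3) K) : Matrix (Fin 3) (Fin 3) K) 1 0) ≤ Valued.v (((g : GL (Fin 3) K) : Matrix (Fin 3) (Fin 3) K) 0 0))
    (h2 : Valued.v (((g : GL (Fin 3) K) : Matrix (Fin 3) (Fin 3) K) 2 0) ≤ Valued.v (((g : GL (Fin 3) K) : Matrix (Fin 3) (Fin 3) K) 0 0)) :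
    ∃ k ∈ (glInt 3 K).comap (unitaryGroupOfForm σ J).subtype, ∃ b ∈ borelU σ J, g = k * b := by
  set c0 := ((g : GL (Fin 3) K) : Matrix (Fin 3) (Fin 3) K) 0 0 with hc0def
  set c1 := ((g : GL (Fin 3) K) : Matrix (Fin 3) (Fin 3) K) 1 0 with hc1def
  set c2 := ((g : GL (Fin 3) K) : Matrix (Fin 3) (Fin 3) K) 2 0 with hc2def
  have hiso := col_zero_isotropic σ hJ g
  rw [← hc0def, ← hc1def, ← hc2def] at hiso
  have hc0 : c0 ≠ 0 := by
    intro h0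
    rw [h0, map_zero, le_zero_iff, map_eq_zero] at h1 h2
    exact col_zero_ne_zero σ g h0 h1 h2
  have hσc0 : σ c0 ≠ 0 := (map_ne_zero σ).2 hc0
  -- the coordinates of the lower unitriangular `k`
  set r := c1 / c0 with hr
  set s := c2 / c0 with hs
  have hrel : s + σ s + (-σ r) * σ (-σ r) = 0 := by
    rw [map_neg, hσσ, hs, hr, map_div₀, map_div₀]
    field_simp
    linear_combination hiso
  obtain ⟨k, hk⟩ := exists_coe_eq_lower σ hJ hσσ hrel
  rw [map_neg, hσσ, neg_neg] at hk
  have hvr : Valued.v r ≤ 1 := by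
    rw [hr, map_div₀]; exact div_le_one_of_le₀ h1 zero_le
  have hvs : Valued.v s ≤ 1 := by
    rw [hs, map_div₀]; exact div_le_one_of_le₀ h2 zero_le
  have hkK : (k : GL (Fin 3) K) ∈ glInt 3 K := by
    refine mem_glInt_of_coe_eq σ hJ hσv hk fun i j => ?_
    fin_cases i <;> fin_cases j <;> simp [Valuation.map_neg, hσv, hvr, hvs]
  refine ⟨k, hkK, k⁻¹ * g, ?_, by group⟩
  -- the lower-left entries of `b = k⁻¹ g` vanish
  have hb : ∀ i j, ((((k⁻¹ * g : ↥(unitaryGroupOfForm σ J))) : GL (Fin 3) K) : Matrix (Fin 3) (Fin 3) K) i j =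
      ∑ l, σ ((((k : GL (Fin 3) K) : Matrix (Fin 3) (Fin 3) K)) (Fin.rev l) (Fin.rev i)) * ((g : GL (Fin 3) K) : Matrix (Fin 3) (Fin 3) K) l j := by
    intro i j
    rw [Subgroup.coe_mul, Subgroup.coe_inv, Units.val_mul, Matrix.mul_apply]
    refine Finset.sum_congr rfl fun l _ => ?_
    rw [inv_apply_of_mem σ hJ k i l]
  have hb10 : ((((k⁻¹ * g : ↥(unitaryGroupOfForm σ J))) : GL (Fin 3) K) : Matrix (Fin 3) (Fin 3) K) 1 0 = 0 := by
    rw [hb, Fin.sum_univ_three]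
    simp only [rev0', rev1', rev2', hk, ← hc0def, ← hc1def, ← hc2def]
    simp [hσσ, hr]
    field_simp
    ring
  have hb20 : ((((k⁻¹ * g : ↥(unitaryGroupOfForm σ J))) : GL (Fin 3) K) : Matrix (Fin 3) (Fin 3) K) 2 0 = 0 := by
    rw [hb, Fin.sum_univ_three]
    simp only [rev0', rev1', rev2', hk, ← hc0def, ← hc1def, ← hc2def]
    simp [hr, hs, map_div₀]
    field_simp
    linear_combination hiso
  have hb00 : ((((k⁻¹ * g : ↥(unitaryGroupOfForm σ J))) : GL (Fin 3) K) : Matrix (Fin 3) (Fin 3) K) 0 0 = c0 := by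
    rw [hb, Fin.sum_univ_three]
    simp only [rev0', rev1', rev2', hk, ← hc0def, ← hc1def, ← hc2def]
    simp
  have hb21 : ((((k⁻¹ * g : ↥(unitaryGroupOfForm σ J))) : GL (Fin 3) K) : Matrix (Fin 3) (Fin 3) K) 2 1 = 0 := by
    have h := sum_rel_of_mem σ hJ (k⁻¹ * g) 0 1
    simp only [Fin.sum_univ_three, rev0', rev1', rev2', hb10, hb20, hb00, map_zero, zero_mul, add_zero] at h
    simpa [hσc0] using h
  rw [mem_borelU_iff]
  intro i j hij
  fin_cases i <;> fin_cases j <;> simp at hij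
  · exact hb10
  · exact hb20
  · exact hb21

omit [ValuativeRel K] [(Valued.v : Valuation K ℤᵐ⁰).Compatible] in
include hJ in
/-- The maximal valuation on an isotropic first column is attained at `c₀` or `c₂`, never strictly at `c₁`
(`|σc₁ c₁| = |c₁|²` could not be cancelled by `|σc₀ c₂ + σc₂ c₀| ≤ |c₀||c₂|`). [cite: Rogawski1990, §1.9 p. 8] [cite: Serre1979, Ch. II §1] -/
theorem not_v_lt_and_v_lt (hσv : ∀ x, Valued.v (σ x) = Valued.v x) (g : ↥(unitaryGroupOfForm σ J))
    (h0 : Valued.v (((g : GL (Fin 3) K) : Matrix (Fin 3) (Fin 3) K) 0 0) < Valued.v (((g : GL (Fin 3) K) : Matrix (Fin 3) (Fin 3) K) 1 0))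
    (h2 : Valued.v (((g : GL (Fin 3) K) : Matrix (Fin 3) (Fin 3) K) 2 0) < Valued.v (((g : GL (Fin 3) K) : Matrix (Fin 3) (Fin 3) K) 1 0)) :
    False := by
  set c0 := ((g : GL (Fin 3) K) : Matrix (Fin 3) (Fin 3) K) 0 0 with hc0def
  set c1 := ((g : GL (Fin 3) K) : Matrix (Fin 3) (Fin 3) K) 1 0 with hc1def
  set c2 := ((g : GL (Fin 3) K) : Matrix (Fin 3) (Fin 3) K) 2 0 with hc2def
  have hiso := col_zero_isotropic σ hJ g
  rw [← hc0def, ← hc1def, ← hc2def] at hiso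
  have h : σ c1 * c1 = -(σ c0 * c2 + σ c2 * c0) := by linear_combination hiso
  have hv : Valued.v c1 * Valued.v c1 ≤ Valued.v c0 * Valued.v c2 := by
    calc Valued.v c1 * Valued.v c1 = Valued.v (σ c1 * c1) := by rw [map_mul, hσv]
      _ = Valued.v (σ c0 * c2 + σ c2 * c0) := by rw [h, Valuation.map_neg]
      _ ≤ max (Valued.v (σ c0 * c2)) (Valued.v (σ c2 * c0)) := Valuation.map_add _ _ _
      _ = Valued.v c0 * Valued.v c2 := by rw [map_mul, map_mul, hσv, hσv, mul_comm (Valued.v c2), max_self]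
  exact absurd (mul_lt_mul'' h0 h2 zero_le zero_le) (not_lt.2 hv)

include hJ in
/-- **THE IWASAWA DECOMPOSITION `U(σ, Φ₃)(K) = K₀ · B` FOR ANY ISOMETRIC INVOLUTION `σ`** (ramified quadratic `K/K^σ` and
residue characteristic `2` included; `K₀ = U ∩ GL₃(𝒪)`, `B` upper triangular): `K₀` acts transitively on the isotropic lines
because a primitive isotropic vector has a UNIT first or last coordinate (`not_v_lt_and_v_lt`); reduce to
`exists_glInt_mul_borel_of_v_le` directly or after the Weyl flip `w₀`. [cite: BruhatTits1972, (4.4.3)] [cite: Tits1979, §3.3.2]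
[cite: Rogawski1990, §1.10 p. 9] -/
theorem exists_glInt_mul_borel (hσσ : ∀ x, σ (σ x) = x) (hσv : ∀ x, Valued.v (σ x) = Valued.v x) (g : ↥(unitaryGroupOfForm σ J)) :
    ∃ k ∈ (glInt 3 K).comap (unitaryGroupOfForm σ J).subtype, ∃ b ∈ borelU σ J, g = k * b := by
  by_cases hA : Valued.v (((g : GL (Fin 3) K) : Matrix (Fin 3) (Fin 3) K) 1 0) ≤ Valued.v (((g : GL (Fin 3) K) : Matrix (Fin 3) (Fin 3) K) 0 0) ∧
      Valued.v (((g : GL (Fin 3) K) : Matrix (Fin 3) (Fin 3) K) 2 0) ≤ Valued.v (((g : GL (Fin 3) K) : Matrix (Fin 3) (Fin 3) K) 0 0)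
  · exact exists_glInt_mul_borel_of_v_le σ hJ hσσ hσv g hA.1 hA.2
  by_cases hB : Valued.v (((g : GL (Fin 3) K) : Matrix (Fin 3) (Fin 3) K) 1 0) ≤ Valued.v (((g : GL (Fin 3) K) : Matrix (Fin 3) (Fin 3) K) 2 0) ∧
      Valued.v (((g : GL (Fin 3) K) : Matrix (Fin 3) (Fin 3) K) 0 0) ≤ Valued.v (((g : GL (Fin 3) K) : Matrix (Fin 3) (Fin 3) K) 2 0)
  · -- flip by `w₀`: the first column of `w₀ g` is `(c₂, c₁, c₀)`
    have hw : ∀ i, ((((weylLongU σ hJ * g : ↥(unitaryGroupOfForm σ J))) : GL (Fin 3) K) : Matrix (Fin 3) (Fin 3) K) i 0 =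
        ((g : GL (Fin 3) K) : Matrix (Fin 3) (Fin 3) K) (Fin.rev i) 0 := by
      intro i
      rw [Subgroup.coe_mul, Units.val_mul, coe_coe_weylLongU_three, Matrix.mul_apply, Fin.sum_univ_three]
      fin_cases i <;> simp [rev1', rev2']
    obtain ⟨k, hk, b, hb, hgb⟩ := exists_glInt_mul_borel_of_v_le σ hJ hσσ hσv (weylLongU σ hJ * g)
      (by rw [hw 1, hw 0, rev1', rev0']; exact hB.1) (by rw [hw 2, hw 0, rev2', rev0']; exact hB.2)
    refine ⟨weylLongU σ hJ * k, Subgroup.mul_mem _ (weylLongU_mem_comap_glInt σ hJ) hk, b, hb, ?_⟩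
    calc g = weylLongU σ hJ * (weylLongU σ hJ * g) := by rw [← mul_assoc, weylLongU_mul_weylLongU, one_mul]
      _ = weylLongU σ hJ * k * b := by rw [hgb, mul_assoc]
  · exfalso
    rw [not_and_or, not_le, not_le] at hA hB
    rcases hA with hA | hA <;> rcases hB with hB | hB
    · exact not_v_lt_and_v_lt σ hJ hσv g hA hB
    · exact not_v_lt_and_v_lt σ hJ hσv g hA (hB.trans hA)
    · exact not_v_lt_and_v_lt σ hJ hσv g (hA.trans hB) hB
    · exact absurd (hA.trans hB) (lt_asymm (hA.trans hB))

end Iwasawa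

/-! ## §2 `N · T ⊂ K₀ · T · K₀`: the big cell absorbs the non-integral unipotents -/

section Core

variable {K : Type*} [Field K] [Valued K ℤᵐ⁰] [ValuativeRel K] [(Valued.v : Valuation K ℤᵐ⁰).Compatible]
  (σ : K →+* K) {J : Matrix (Fin 3) (Fin 3) K} (hJ : J = (StdForm.antidiagonal 3).over K)

include hJ in
/-- **CORE OF THE CARTAN DECOMPOSITION.**  For `t = diag(d) ∈ T` with `|d₀| ≥ 1` and `n = u(x, z) ∈ N`: `t n ∈ K₀ T K₀`.  If `|z| ≤ 1`
then `n ∈ K₀`; otherwise the big cell `n = k₁ D w₀ k₂` (`upper_eq_lower_mul_diag_mul_weyl_mul_lower`, `k₁, k₂ ∈ N̄ ∩ K₀`) gives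
`t n = (t k₁ t⁻¹) · (t D) · (w₀ k₂)` and `t k₁ t⁻¹` is still integral because conjugation by `t` DIVIDES the lower entries by
`d₀∕d₁`, `d₀∕d₂`, `d₁∕d₂`, all of valuation `≥ 1`. [cite: BruhatTits1972, (4.4.3)] [cite: Casselman1995, Prop. 1.3.1] [cite: Rogawski1990, §1.10 p. 9] -/
theorem exists_torus_mul_unipotent_eq (hσσ : ∀ x, σ (σ x) = x) (hσv : ∀ x, Valued.v (σ x) = Valued.v x)
    {t n : ↥(unitaryGroupOfForm σ J)} (ht : t ∈ torusU σ J) (hn : n ∈ unipotentU σ J)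
    (ht0 : 1 ≤ Valued.v (((t : GL (Fin 3) K) : Matrix (Fin 3) (Fin 3) K) 0 0)) :
    ∃ k₁ ∈ (glInt 3 K).comap (unitaryGroupOfForm σ J).subtype, ∃ t' ∈ torusU σ J,
      ∃ k₂ ∈ (glInt 3 K).comap (unitaryGroupOfForm σ J).subtype, t * n = k₁ * t' * k₂ := by
  obtain ⟨x, z, hnM, hrel⟩ := exists_coe_eq_upper_of_mem_unipotentU σ hJ hσσ hn
  by_cases hz : Valued.v z ≤ 1
  · have hx : Valued.v x ≤ 1 := v_le_one_of_rel σ hσv hrel hz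
    have hnK : (n : GL (Fin 3) K) ∈ glInt 3 K := by
      refine mem_glInt_of_coe_eq σ hJ hσv hnM fun i j => ?_
      fin_cases i <;> fin_cases j <;> simp [Valuation.map_neg, hσv, hx, hz]
    exact ⟨1, Subgroup.one_mem _, t, ht, n, hnK, by rw [one_mul]⟩
  rw [not_le] at hz
  obtain ⟨d, htM, hd20, hd11, hd02⟩ := exists_coe_eq_diagonal_of_mem_torusU σ hJ ht
  have ht00 : ((t : GL (Fin 3) K) : Matrix (Fin 3) (Fin 3) K) 0 0 = d 0 := by rw [htM, Matrix.diagonal_apply_eq]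
  rw [ht00] at ht0
  have hz0 : z ≠ 0 := by
    intro h; rw [h, map_zero] at hz; exact absurd hz (not_lt.2 zero_le)
  have hσz0 : σ z ≠ 0 := (map_ne_zero σ).2 hz0
  have hxz : Valued.v x ≤ Valued.v z := v_le_v_of_rel σ hσv hrel hz
  -- the relations of the three explicit factors
  have hrel₁ : z⁻¹ + σ z⁻¹ + (x * (σ z)⁻¹) * σ (x * (σ z)⁻¹) = 0 := by
    rw [map_mul, map_inv₀, map_inv₀, hσσ]
    field_simp
    linear_combination hrel
  have hrel₂ : z⁻¹ + σ z⁻¹ + (x * z⁻¹) * σ (x * z⁻¹) = 0 := by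
    rw [map_mul, map_inv₀]
    field_simp
    linear_combination hrel
  have hβ : σ (-(σ z * z⁻¹)) * (-(σ z * z⁻¹)) = 1 := by
    rw [map_neg, map_mul, map_inv₀, hσσ]
    field_simp
  obtain ⟨k₁, hk₁⟩ := exists_coe_eq_lower σ hJ hσσ hrel₁
  obtain ⟨D, hDT, hD⟩ := exists_coe_eq_diag σ hJ hσσ hz0 hβ
  obtain ⟨k₂, hk₂⟩ := exists_coe_eq_lower σ hJ hσσ hrel₂
  rw [map_mul, map_inv₀, hσσ] at hk₁
  rw [map_mul, map_inv₀] at hk₂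
  -- the big cell inside `U`
  have hid : n = k₁ * D * weylLongU σ hJ * k₂ := by
    apply Subtype.ext
    apply Units.ext
    simp only [Subgroup.coe_mul, Units.val_mul]
    rw [hnM, hk₁, hD, coe_coe_weylLongU_three, hk₂]
    exact upper_eq_lower_mul_diag_mul_weyl_mul_lower x (σ x) z (σ z) hz0 hσz0 hrel
  -- valuations of the torus entries
  have hvd1 : Valued.v (d 1 : K) = 1 := by
    have h := congrArg Valued.v hd11
    rw [map_mul, map_one, hσv] at h
    exact Literature.NumberTheory.QuadraticForms.OMeara65.WithZeroMulInt.eq_one_of_mul_self h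
  have hvd2 : Valued.v (d 2 : K) = (Valued.v (d 0 : K))⁻¹ := by
    have h := congrArg Valued.v hd02
    rw [map_mul, map_one, hσv] at h
    exact eq_inv_of_mul_eq_one_right h
  have hvd0i : (Valued.v (d 0 : K))⁻¹ ≤ 1 := inv_le_one_of_one_le₀ ht0
  have hvd2' : Valued.v (d 2 : K) ≤ 1 := by rw [hvd2]; exact hvd0i
  -- valuations of the big-cell coordinates
  have hvxz : Valued.v x * (Valued.v z)⁻¹ ≤ 1 := mul_inv_le_one_of_le₀ hxz zero_le
  have hvzi : (Valued.v z)⁻¹ ≤ 1 := inv_le_one_of_one_le₀ hz.le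
  have hk₂K : (k₂ : GL (Fin 3) K) ∈ glInt 3 K := by
    refine mem_glInt_of_coe_eq σ hJ hσv hk₂ fun i j => ?_
    fin_cases i <;> fin_cases j <;> simp [Valuation.map_neg, map_mul, map_inv₀, hσv, hvxz, hvzi]
  -- the conjugate `t k₁ t⁻¹`: its matrix and its integrality
  have htinv : ((((t : ↥(unitaryGroupOfForm σ J)) : GL (Fin 3) K)⁻¹ : GL (Fin 3) K) : Matrix (Fin 3) (Fin 3) K) =
      Matrix.diagonal fun j => σ ((d (Fin.rev j) : K)) := by
    ext i j
    rw [inv_apply_of_mem σ hJ t, htM, Matrix.diagonal_apply, Matrix.diagonal_apply]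
    by_cases h : i = j
    · subst h; rw [if_pos rfl, if_pos rfl]
    · rw [if_neg (fun h' => h (Fin.rev_injective h').symm), if_neg h, map_zero]
  have hconjM : ((((t * k₁ * t⁻¹ : ↥(unitaryGroupOfForm σ J))) : GL (Fin 3) K) : Matrix (Fin 3) (Fin 3) K) =
      !![(d 0 : K) * σ (d 2 : K), 0, 0;
        -((d 1 : K) * (σ x * z⁻¹) * σ (d 2 : K)), (d 1 : K) * σ (d 1 : K), 0;
        (d 2 : K) * z⁻¹ * σ (d 2 : K), (d 2 : K) * (x * (σ z)⁻¹) * σ (d 1 : K), (d 2 : K) * σ (d 0 : K)] := by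
    rw [Subgroup.coe_mul, Subgroup.coe_mul, Subgroup.coe_inv, Units.val_mul, Units.val_mul, htinv, htM, hk₁]
    ext i j
    fin_cases i <;> fin_cases j <;> simp [Matrix.mul_diagonal, Matrix.diagonal_mul, rev1', rev2']
  have hconjK : (((t * k₁ * t⁻¹ : ↥(unitaryGroupOfForm σ J))) : GL (Fin 3) K) ∈ glInt 3 K := by
    refine mem_glInt_of_coe_eq σ hJ hσv hconjM fun i j => ?_
    have h00 : Valued.v ((d 0 : K) * σ (d 2 : K)) ≤ 1 := by rw [mul_comm, hd20, map_one]
    have h11 : Valued.v ((d 1 : K) * σ (d 1 : K)) ≤ 1 := by rw [mul_comm, hd11, map_one]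
    have h22 : Valued.v ((d 2 : K) * σ (d 0 : K)) ≤ 1 := by rw [mul_comm, hd02, map_one]
    have h10 : Valued.v (-((d 1 : K) * (σ x * z⁻¹) * σ (d 2 : K))) ≤ 1 := by
      rw [Valuation.map_neg, map_mul, map_mul, map_mul, map_inv₀, hvd1, one_mul, hσv, hσv]
      exact mul_le_one' hvxz hvd2'
    have h20 : Valued.v ((d 2 : K) * z⁻¹ * σ (d 2 : K)) ≤ 1 := by
      rw [map_mul, map_mul, map_inv₀, hσv]
      exact mul_le_one' (mul_le_one' hvd2' hvzi) hvd2'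
    have h21 : Valued.v ((d 2 : K) * (x * (σ z)⁻¹) * σ (d 1 : K)) ≤ 1 := by
      rw [map_mul, map_mul, map_mul, map_inv₀, hσv, hσv, hvd1, mul_one]
      exact mul_le_one' hvd2' hvxz
    fin_cases i <;> fin_cases j
    · exact h00
    · simp
    · simp
    · exact h10
    · exact h11
    · simp
    · exact h20
    · exact h21
    · exact h22
  refine ⟨t * k₁ * t⁻¹, hconjK, t * D, Subgroup.mul_mem _ ht hDT, weylLongU σ hJ * k₂,
    Subgroup.mul_mem _ (weylLongU_mem_comap_glInt σ hJ) hk₂K, ?_⟩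
  rw [hid]; group

include hJ in
/-- `n t ∈ K₀ T K₀` for `n ∈ N`, `t = diag(d) ∈ T` with `|d₀| ≥ 1` (conjugate `n` into `N` past `t` and use
`exists_torus_mul_unipotent_eq`). [cite: BruhatTits1972, (4.4.3)] [cite: Rogawski1990, §1.10 p. 9] -/
theorem exists_unipotent_mul_torus_eq_of_one_le (hσσ : ∀ x, σ (σ x) = x) (hσv : ∀ x, Valued.v (σ x) = Valued.v x)
    {t n : ↥(unitaryGroupOfForm σ J)} (ht : t ∈ torusU σ J) (hn : n ∈ unipotentU σ J)
    (ht0 : 1 ≤ Valued.v (((t : GL (Fin 3) K) : Matrix (Fin 3) (Fin 3) K) 0 0)) :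
    ∃ k₁ ∈ (glInt 3 K).comap (unitaryGroupOfForm σ J).subtype, ∃ t' ∈ torusU σ J,
      ∃ k₂ ∈ (glInt 3 K).comap (unitaryGroupOfForm σ J).subtype, n * t = k₁ * t' * k₂ := by
  obtain ⟨k₁, hk₁, t', ht', k₂, hk₂, h⟩ :=
    exists_torus_mul_unipotent_eq σ hJ hσσ hσv ht (inv_mul_mul_mem_unipotentU σ hJ ht hn) ht0
  refine ⟨k₁, hk₁, t', ht', k₂, hk₂, ?_⟩
  rw [← h]; group

include hJ in
/-- **`N · T ⊂ K₀ · T · K₀`** (any `t ∈ T`: if `|d₀| < 1` pass to the inverse `(n t)⁻¹ = t⁻¹ n⁻¹`, whose torus part has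
`|(t⁻¹)₀₀| = |d₀|⁻¹ > 1`). [cite: BruhatTits1972, (4.4.3)] [cite: Rogawski1990, §1.10 p. 9] -/
theorem exists_unipotent_mul_torus_eq (hσσ : ∀ x, σ (σ x) = x) (hσv : ∀ x, Valued.v (σ x) = Valued.v x)
    {t n : ↥(unitaryGroupOfForm σ J)} (ht : t ∈ torusU σ J) (hn : n ∈ unipotentU σ J) :
    ∃ k₁ ∈ (glInt 3 K).comap (unitaryGroupOfForm σ J).subtype, ∃ t' ∈ torusU σ J,
      ∃ k₂ ∈ (glInt 3 K).comap (unitaryGroupOfForm σ J).subtype, n * t = k₁ * t' * k₂ := by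
  by_cases ht0 : 1 ≤ Valued.v (((t : GL (Fin 3) K) : Matrix (Fin 3) (Fin 3) K) 0 0)
  · exact exists_unipotent_mul_torus_eq_of_one_le σ hJ hσσ hσv ht hn ht0
  rw [not_le] at ht0
  obtain ⟨d, htM, -, -, hd02⟩ := exists_coe_eq_diagonal_of_mem_torusU σ hJ ht
  have hd0 : ((t : GL (Fin 3) K) : Matrix (Fin 3) (Fin 3) K) 0 0 = d 0 := by rw [htM, Matrix.diagonal_apply_eq]
  rw [hd0] at ht0
  have hti0 : 1 ≤ Valued.v ((((t⁻¹ : ↥(unitaryGroupOfForm σ J)) : GL (Fin 3) K) : Matrix (Fin 3) (Fin 3) K) 0 0) := by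
    rw [Subgroup.coe_inv, inv_apply_of_mem σ hJ t 0 0, rev0', htM, Matrix.diagonal_apply_eq, hσv]
    have h := congrArg Valued.v hd02
    rw [map_mul, map_one, hσv] at h
    rw [eq_inv_of_mul_eq_one_right h]
    exact (one_le_inv₀ (zero_lt_iff.2 ((Valuation.ne_zero_iff _).2 (d 0).ne_zero))).2 ht0.le
  obtain ⟨k₁, hk₁, t', ht', k₂, hk₂, h⟩ :=
    exists_torus_mul_unipotent_eq σ hJ hσσ hσv (Subgroup.inv_mem _ ht) (Subgroup.inv_mem _ hn) hti0
  refine ⟨k₂⁻¹, Subgroup.inv_mem _ hk₂, t'⁻¹, Subgroup.inv_mem _ ht', k₁⁻¹, Subgroup.inv_mem _ hk₁, ?_⟩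
  have hnt : n * t = (t⁻¹ * n⁻¹)⁻¹ := by group
  rw [hnt, h]; group

end Core

end UnitaryGroup

end Literature.NumberTheory.Automorphic
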